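import Mathlib

/-!
# ChartedPlanarOrder — line P-a step (L-b), sitewise: the FIRST-ORDER term of a site energy is an antisymmetric PAIR FLUX
(divergence of a transport) under force balance at that site  (DEF-FREE helper; lens-3 g19)

For pair coefficients `c i j : ℝ` (think `½·V′(r⁰_ij)/r⁰_ij`) and bond vectors `e i j` (think `y_i − y_j`) with the ACTION–REACTION symmetry
`c i j • e i j = -(c j i • e j i)`, and FORCE BALANCE at the site `x` (`∑_j c x j • e x j = 0`), the first-order variation of the site energy
`∑_j c x j * ⟪e x j, u x − u j⟫` under a displacement `u` equals `∑_j (g x j − g j x)` with the flux `g i j := -⟪c i j • e i j, u j⟫`: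
site by site it is the net OUT-flow minus IN-flow of a covariant pair transport, so its mean under any point-stationary law vanishes by the
mass-transport principle (tree: `FrustratedLawDichotomyTransportPrice.integral_redistributed_eq`; lens-3 g19 `quadMeanCoercivity_of_pertSiteCalibration`).
Pure finite-sum algebra; no `def`.
-/

namespace Summit.AtomisticToContinuum.Crystallization.Theorems.ChartedPlanarOrderFirstOrderTransport

open scoped RealInnerProductSpace

variable {ι : Type*} {E : Type*} [NormedAddCommGroup E] [InnerProductSpace ℝ E]

/-- **first-order term = divergence of a pair flux** (force balance at `x` + action–reaction). -/
theorem firstOrder_eq_flux_divergence (S : Finset ι) (c : ι → ι → ℝ) (e : ι → ι → E) (u : ι → E) (x : ι)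
    (hanti : ∀ i j, c i j • e i j = -(c j i • e j i)) (hbal : ∑ j ∈ S, c x j • e x j = 0) :
    ∑ j ∈ S, c x j * ⟪e x j, u x - u j⟫ =
      ∑ j ∈ S, ((-⟪c x j • e x j, u j⟫) - (-⟪c j x • e j x, u x⟫)) := by
  have h1 : ∑ j ∈ S, c x j * ⟪e x j, u x - u j⟫ =
      ∑ j ∈ S, (⟪c x j • e x j, u x⟫ - ⟪c x j • e x j, u j⟫) := by
    refine Finset.sum_congr rfl fun j _ => ?_
    rw [inner_sub_right, real_inner_smul_left, real_inner_smul_left, mul_sub]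
  have h2 : ∑ j ∈ S, ⟪c x j • e x j, u x⟫ = 0 := by
    rw [← sum_inner, hbal, inner_zero_left]
  have h3 : ∑ j ∈ S, ⟪c j x • e j x, u x⟫ = 0 := by
    have : ∑ j ∈ S, ⟪c j x • e j x, u x⟫ = -∑ j ∈ S, ⟪c x j • e x j, u x⟫ := by
      rw [← Finset.sum_neg_distrib]
      refine Finset.sum_congr rfl fun j _ => ?_
      rw [← inner_neg_left, ← hanti]
    rw [this, h2, neg_zero]
  rw [h1, Finset.sum_sub_distrib, Finset.sum_sub_distrib, h2, Finset.sum_neg_distrib, Finset.sum_neg_distrib, h3]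
  ring

/-- the same with the TOTAL first-order term written against relative displacements `u j − u x` (sign convention of a Taylor expansion
`V(‖e + (u_j − u_x)‖) ≈ V(‖e‖) + (V′/‖e‖)⟪e, u_j − u_x⟫`, `e = y_j − y_x`): it is MINUS the divergence above. -/
theorem firstOrder_rel_eq_flux_divergence (S : Finset ι) (c : ι → ι → ℝ) (e : ι → ι → E) (u : ι → E) (x : ι)
    (hanti : ∀ i j, c i j • e i j = -(c j i • e j i)) (hbal : ∑ j ∈ S, c x j • e x j = 0) :
    ∑ j ∈ S, c x j * ⟪e x j, u j - u x⟫ =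
      ∑ j ∈ S, (⟪c x j • e x j, u j⟫ - ⟪c j x • e j x, u x⟫) := by
  have h := firstOrder_eq_flux_divergence S c e u x hanti hbal
  have hneg : ∑ j ∈ S, c x j * ⟪e x j, u j - u x⟫ = -∑ j ∈ S, c x j * ⟪e x j, u x - u j⟫ := by
    rw [← Finset.sum_neg_distrib]
    refine Finset.sum_congr rfl fun j _ => ?_
    rw [← neg_sub, inner_neg_right, mul_neg]
  rw [hneg, h, ← Finset.sum_neg_distrib]
  refine Finset.sum_congr rfl fun j _ => ?_
  ring

/-- summed over all sites of a finite balanced cluster the first-order term VANISHES (the finite shadow of the MTP cancellation). -/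
theorem sum_firstOrder_eq_zero (S : Finset ι) (c : ι → ι → ℝ) (e : ι → ι → E) (u : ι → E)
    (hanti : ∀ i j, c i j • e i j = -(c j i • e j i)) (hbal : ∀ x ∈ S, ∑ j ∈ S, c x j • e x j = 0) :
    ∑ x ∈ S, ∑ j ∈ S, c x j * ⟪e x j, u j - u x⟫ = 0 := by
  have h : ∀ x ∈ S, ∑ j ∈ S, c x j * ⟪e x j, u j - u x⟫ = ∑ j ∈ S, (⟪c x j • e x j, u j⟫ - ⟪c j x • e j x, u x⟫) :=
    fun x hx => firstOrder_rel_eq_flux_divergence S c e u x hanti (hbal x hx)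
  rw [Finset.sum_congr rfl h]
  simp only [Finset.sum_sub_distrib]
  rw [Finset.sum_comm, sub_self]

end Summit.AtomisticToContinuum.Crystallization.Theorems.ChartedPlanarOrderFirstOrderTransport
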